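import Literature.GroupTheory.ArithmeticGroups.SL2PrimePowSchurMultiplier
import Literature.GroupTheory.ArithmeticGroups.SL2PrimePowCentralExtensionOdd
import HarnessLib

/-!
# The `p`-primary part of the Schur multiplier of `SL₂(ℤ/p^e)` vanishes for every odd prime `p` (Beyl)

**Theorem** (`eq_one_of_mem_ker_of_mem_commutator_odd`). Let `p` be an odd prime, `e ≥ 0`, and
`π : E → SL₂(ℤ/p^e)` a surjection whose kernel is central of exponent `p`.  Then `ker π ∩ [E, E] = 1`.

This is `SL2PrimePowSchurMultiplier` with the torus step replaced by the TWIST of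
`SL2PrimePowCentralExtensionOdd`: the descent `e → e-1` uses the normal subgroup `W' = ⟨e₀w, h₁w, f₀w⁻¹⟩`
(`w = zt^{(p-1)/2}`, `zt` the `T̄`-cocycle constant), which needs only that the kernel has ODD exponent.  Hence
`p = 3` is covered (all `e`), where `SL₂(ℤ/9) → SL₂(𝔽₃)` splits and there is no torus.  Base case and the
bookkeeping lemmas are those of `SL2PrimePowSchurMultiplier`.  [Beyl1986]; this is the group theory behind
[CalegariDimitrovTang2025, Cor. 4.5.3] at the primes `ℓ = p` odd with `p² ∣ N`.
-/

open scoped MatrixGroups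
open Matrix Matrix.SpecialLinearGroup

namespace Literature.GroupTheory.ArithmeticGroups

namespace SL2SchurMultiplierOdd

open Literature.GroupTheory.ArithmeticGroups.SL2SchurMultiplier
variable {p e : ℕ} {E : Type*} [Group E] {π : E →* SL(2, ZMod (p ^ e))}

section stepodd

variable (hcen : ∀ z : E, π z = 1 → ∀ g : E, g * z = z * g) (hexp : ∀ z : E, π z = 1 → z ^ p = 1)
variable {t l e₀ f₀ h₁ : E} (he₀ : e₀ = t ^ p ^ (e - 1)) (hf₀ : f₀ = l ^ p ^ (e - 1))
  (hh₁ : h₁ = t * f₀ * t⁻¹ * f₀⁻¹ * e₀)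
  (ht : ((π t : SL(2, ZMod (p ^ e))) : Matrix (Fin 2) (Fin 2) (ZMod (p ^ e))) = !![1, 1; 0, 1])
  (hl : ((π l : SL(2, ZMod (p ^ e))) : Matrix (Fin 2) (Fin 2) (ZMod (p ^ e))) = !![1, 0; 1, 1])

include hcen hexp he₀ hf₀ hh₁ ht hl in

/-- **`W' = ⟨e', h', f'⟩` (twisted generators) is normal in `E`** for a surjective central exponent-`p`
extension of `SL₂(ℤ/p^e)`, `p` odd, `e ≥ 2`: the twisted descent relations and `SL₂(ℤ/p^e) = ⟨T̄, L̄⟩`. [cite: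
Beyl1986, Theorem (M(SL(2,ℤ/m)) = 0 for 4 ∤ m), p-primary part] -/
theorem closure_normal_odd [Fact p.Prime] (hp2 : p ≠ 2) (he : 2 ≤ e)
    {w e' h' f' : E} (hw1 : π w = 1) (htw : t * h₁ * t⁻¹ = h₁ * e₀⁻¹ * e₀⁻¹ * w⁻¹ * w⁻¹)
    (he' : e' = e₀ * w) (hh' : h' = h₁ * w) (hf' : f' = f₀ * w⁻¹) :
    (Subgroup.closure ({e', h', f'} : Set E)).Normal := by
  have hp : p.Prime := Fact.out
  obtain ⟨⟨pe, ph, pf⟩, ⟨rte, rtf, rlf⟩, rth, rle, rlh, ⟨rth', rtf'⟩, ⟨rlh', rle'⟩⟩ :=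
    SL2CentralExtensionOdd.descent_relations_twisted hcen hexp he₀ hf₀ hh₁ ht hl hp2 he hw1 htw he' hh' hf'
  have rte' : t⁻¹ * e' * t = e' := by
    calc t⁻¹ * e' * t = t⁻¹ * (t * e' * t⁻¹) * t := by rw [rte]
      _ = e' := by group
  have rlf' : l⁻¹ * f' * l = f' := by
    calc l⁻¹ * f' * l = l⁻¹ * (l * f' * l⁻¹) * l := by rw [rlf]
      _ = f' := by group
  set W := Subgroup.closure ({e', h', f'} : Set E) with hW
  obtain ⟨meW, mhW, mfW⟩ := (gens_mem_closure : e' ∈ W ∧ h' ∈ W ∧ f' ∈ W)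
  -- conjugation by t, t⁻¹, l, l⁻¹ and kernel elements preserves W
  have ct : ∀ w ∈ W, t * w * t⁻¹ ∈ W := fun w hw ↦ conj_mem_closure_of_gens
    (by rw [rte]; exact meW)
    (by rw [rth]; exact W.mul_mem (W.mul_mem mhW (W.inv_mem meW)) (W.inv_mem meW))
    (by rw [rtf]; exact W.mul_mem (W.mul_mem mhW (W.inv_mem meW)) mfW) hw
  have ct' : ∀ w ∈ W, t⁻¹ * w * t⁻¹⁻¹ ∈ W := fun w hw ↦ conj_mem_closure_of_gens (g := t⁻¹)
    (by rw [inv_inv, rte']; exact meW)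
    (by rw [inv_inv, rth']; exact W.mul_mem (W.mul_mem mhW meW) meW)
    (by rw [inv_inv, rtf']; exact W.mul_mem (W.mul_mem mfW (W.inv_mem mhW)) (W.inv_mem meW)) hw
  have cl : ∀ w ∈ W, l * w * l⁻¹ ∈ W := fun w hw ↦ conj_mem_closure_of_gens
    (by rw [rle]; exact W.mul_mem (W.mul_mem meW (W.inv_mem mhW)) (W.inv_mem mfW))
    (by rw [rlh]; exact W.mul_mem (W.mul_mem mhW mfW) mfW)
    (by rw [rlf]; exact mfW) hw
  have cl' : ∀ w ∈ W, l⁻¹ * w * l⁻¹⁻¹ ∈ W := fun w hw ↦ conj_mem_closure_of_gens (g := l⁻¹)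
    (by rw [inv_inv, rle']; exact W.mul_mem (W.mul_mem meW mhW) (W.inv_mem mfW))
    (by rw [inv_inv, rlh']; exact W.mul_mem (W.mul_mem mhW (W.inv_mem mfW)) (W.inv_mem mfW))
    (by rw [inv_inv, rlf']; exact mfW) hw
  -- normalizer contains t, l and the kernel
  have ntl : ∀ g : E, (∀ w ∈ W, g * w * g⁻¹ ∈ W) → (∀ w ∈ W, g⁻¹ * w * g⁻¹⁻¹ ∈ W) → g ∈ Subgroup.normalizer (W : Set E) := by
    intro g hg hg'
    rw [Subgroup.mem_normalizer_iff]
    intro w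
    refine ⟨hg w, fun hw ↦ ?_⟩
    have := hg' _ hw
    rwa [inv_inv, ← mul_assoc, ← mul_assoc, inv_mul_cancel, one_mul, mul_assoc, inv_mul_cancel,
      mul_one] at this
  have hzn : ∀ z : E, π z = 1 → z ∈ Subgroup.normalizer (W : Set E) := by
    intro z hz
    rw [Subgroup.mem_normalizer_iff]
    intro w
    rw [← hcen z hz w, mul_assoc, mul_inv_cancel, mul_one]
  have htn : t ∈ Subgroup.normalizer (W : Set E) := ntl t ct ct'
  have hln : l ∈ Subgroup.normalizer (W : Set E) := ntl l cl cl'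
  -- hence everything
  haveI : NeZero (p ^ e) := ⟨pow_ne_zero _ hp.ne_zero⟩
  have htop : Subgroup.normalizer (W : Set E) = ⊤ := by
    rw [eq_top_iff]
    intro g _
    have hg : π g ∈ Subgroup.map π (Subgroup.closure ({t, l} : Set E)) := by
      rw [MonoidHom.map_closure, Set.image_pair, SL2TopLayer.closure_T_L_eq_top (p ^ e) (π t) (π l) ht hl]
      trivial
    obtain ⟨g', hg', hgg'⟩ := hg
    obtain ⟨z, hz, rfl⟩ := SL2CentralExtension.exists_eq_mul_of_map_eq hgg'.symm
    refine (Subgroup.normalizer (W : Set E)).mul_mem ?_ (hzn z hz)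
    exact (Subgroup.closure_le (K := Subgroup.normalizer (W : Set E))).mpr
      (by intro x hx; simp only [Set.mem_insert_iff, Set.mem_singleton_iff] at hx
          rcases hx with rfl | rfl; exacts [htn, hln]) hg'
  exact Subgroup.normalizer_eq_top_iff.mp htop


end stepodd

section induction

universe u

/-- **Inductive step, odd `p`.** If every central exponent-`p` extension of `SL₂(ℤ/p^{e-1})` has `ker ∩ [·,·] =
1`, so does every central exponent-`p` extension `E` of `SL₂(ℤ/p^e)` (`e ≥ 2`): with `zt` the `T̄`-cocycle
constant and `w = zt^{(p-1)/2}` (so `w⁻² = zt`), the twisted `W'` is normal, meets the kernel trivially,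
`π⁻¹(layer) = W'·ker π`, and `E/W'` is a central exponent-`p` extension of `SL₂(ℤ/p^{e-1})`. [cite: Beyl1986,
Theorem (M(SL(2,ℤ/m)) = 0 for 4 ∤ m), p-primary part] -/
theorem step_odd (p : ℕ) [Fact p.Prime] (hp2 : p ≠ 2) (e : ℕ) (he : 2 ≤ e) {E : Type u} [Group E]
    (π : E →* SL(2, ZMod (p ^ e))) (hsurj : Function.Surjective π)
    (hcen : ∀ z : E, π z = 1 → ∀ g : E, g * z = z * g) (hexp : ∀ z : E, π z = 1 → z ^ p = 1)
    (IH : ∀ (E' : Type u) [Group E'] (π' : E' →* SL(2, ZMod (p ^ (e - 1)))), Function.Surjective π' →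
      (∀ z : E', π' z = 1 → ∀ g : E', g * z = z * g) → (∀ z : E', π' z = 1 → z ^ p = 1) →
      ∀ z : E', π' z = 1 → z ∈ commutator E' → z = 1) :
    ∀ z : E, π z = 1 → z ∈ commutator E → z = 1 := by
  have hp : p.Prime := Fact.out
  haveI : NeZero (p ^ e) := ⟨pow_ne_zero _ hp.ne_zero⟩
  haveI : NeZero (p ^ (e - 1)) := ⟨pow_ne_zero _ hp.ne_zero⟩
  obtain ⟨t, ht'⟩ := hsurj ⟨!![1, 1; 0, 1], by simp [Matrix.det_fin_two_of]⟩
  obtain ⟨l, hl'⟩ := hsurj ⟨!![1, 0; 1, 1], by simp [Matrix.det_fin_two_of]⟩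
  have ht : ((π t : SL(2, ZMod (p ^ e))) : Matrix (Fin 2) (Fin 2) (ZMod (p ^ e))) = !![1, 1; 0, 1] := by
    rw [ht']
  have hl : ((π l : SL(2, ZMod (p ^ e))) : Matrix (Fin 2) (Fin 2) (ZMod (p ^ e))) = !![1, 0; 1, 1] := by
    rw [hl']
  set e₀ : E := t ^ p ^ (e - 1) with he₀
  set f₀ : E := l ^ p ^ (e - 1) with hf₀
  set h₁ : E := t * f₀ * t⁻¹ * f₀⁻¹ * e₀ with hh₁
  have hϖ := SL2TopLayer.varpi_mul_varpi p e he
  have hE0 := SL2CentralExtension.coe_map_e₀' he₀ ht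
  have hF0 := SL2CentralExtension.coe_map_f₀' hf₀ hl
  have hH0 := SL2CentralExtension.coe_map_h₁' he₀ hf₀ hh₁ ht hl he
  have heh0 := SL2CentralExtension.commute_e₀_h₁ hcen he₀ hf₀ hh₁ ht hl he
  have hfh0 := SL2CentralExtension.commute_f₀_h₁ hcen he₀ hf₀ hh₁ ht hl he
  have hef0 := SL2CentralExtension.commute_e₀_f₀ hcen hexp he₀ hf₀ hh₁ ht hl he hp2
  -- the twisting element
  set zt : E := (h₁ * e₀⁻¹ * e₀⁻¹)⁻¹ * (t * h₁ * t⁻¹) with hzt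
  have hπzt : π zt = 1 := by
    rw [hzt]
    simp only [map_mul, map_inv]
    rw [SL2TopLayer.tBar_conj_hBar _ (π t) (π e₀) (π h₁) hϖ ht hE0 hH0, inv_mul_cancel]
  set w : E := zt ^ ((p - 1) / 2) with hwdef
  have hw1 : π w = 1 := by rw [hwdef, map_pow, hπzt, one_pow]
  have hwc : ∀ x : E, Commute w x := fun x ↦ (hcen w hw1 x).symm
  have hww : w⁻¹ * w⁻¹ = zt := by
    have h2 : (p - 1) / 2 * 2 = p - 1 := Nat.div_mul_cancel (hp.even_sub_one hp2).two_dvd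
    have h3 : w * w * zt = 1 := by
      rw [hwdef, ← pow_two, ← pow_mul, h2, ← pow_succ, Nat.sub_add_cancel hp.one_le, hexp zt hπzt]
    rw [← _root_.mul_inv_rev, inv_eq_iff_mul_eq_one, ← h3]
  have htw : t * h₁ * t⁻¹ = h₁ * e₀⁻¹ * e₀⁻¹ * w⁻¹ * w⁻¹ := by
    rw [mul_assoc (h₁ * e₀⁻¹ * e₀⁻¹), hww, hzt]; group
  set e' : E := e₀ * w with he'
  set h' : E := h₁ * w with hh'
  set f' : E := f₀ * w⁻¹ with hf'
  set W : Subgroup E := Subgroup.closure ({e', h', f'} : Set E) with hW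
  haveI hWn : W.Normal := closure_normal_odd hcen hexp he₀ hf₀ hh₁ ht hl hp2 he hw1 htw he' hh' hf'
  obtain ⟨⟨pe, ph, pf⟩, -⟩ :=
    SL2CentralExtensionOdd.descent_relations_twisted hcen hexp he₀ hf₀ hh₁ ht hl hp2 he hw1 htw he' hh' hf'
  have hE : ((π e' : SL(2, ZMod (p ^ e))) : Matrix (Fin 2) (Fin 2) (ZMod (p ^ e))) =
      !![1, (p : ZMod (p ^ e)) ^ (e - 1); 0, 1] := by rw [he', map_mul, hw1, mul_one]; exact hE0
  have hF : ((π f' : SL(2, ZMod (p ^ e))) : Matrix (Fin 2) (Fin 2) (ZMod (p ^ e))) =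
      !![1, 0; (p : ZMod (p ^ e)) ^ (e - 1), 1] := by
    rw [hf', map_mul, map_inv, hw1, inv_one, mul_one]; exact hF0
  have hH : ((π h' : SL(2, ZMod (p ^ e))) : Matrix (Fin 2) (Fin 2) (ZMod (p ^ e))) =
      !![1 + (p : ZMod (p ^ e)) ^ (e - 1), 0; 0, 1 - (p : ZMod (p ^ e)) ^ (e - 1)] := by
    rw [hh', map_mul, hw1, mul_one]; exact hH0
  have heh : Commute e' h' :=
    ((heh0.mul_right (hwc e₀).symm).mul_left ((hwc h₁).mul_right (hwc w)))
  have hfh : Commute f' h' :=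
    ((hfh0.mul_right (hwc f₀).symm).mul_left ((hwc h₁).inv_left.mul_right (hwc w).inv_left))
  have hef : Commute e' f' :=
    ((hef0.mul_right (hwc e₀).inv_left.symm).mul_left ((hwc f₀).mul_right (hwc w⁻¹)))
  -- the reduction and the quotient map
  set r := Matrix.SpecialLinearGroup.map (n := Fin 2)
    (ZMod.castHom (pow_dvd_pow p (Nat.sub_le e 1)) (ZMod (p ^ (e - 1)))) with hr
  have hrw : r (π w) = 1 := by rw [hw1, map_one]
  have hWker : W ≤ (r.comp π).ker := by
    rw [hW, Subgroup.closure_le]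
    intro x hx
    simp only [Set.mem_insert_iff, Set.mem_singleton_iff] at hx
    rw [SetLike.mem_coe, MonoidHom.mem_ker, MonoidHom.comp_apply]
    rcases hx with rfl | rfl | rfl
    · rw [map_mul, map_mul, hrw, mul_one]; exact SL2CentralExtension.layer_e₀ he₀ ht
    · rw [map_mul, map_mul, hrw, mul_one]; exact SL2CentralExtension.layer_h₁ he₀ hf₀ hh₁ ht hl he
    · rw [map_mul, map_mul, map_inv, map_inv, hrw, inv_one, mul_one]
      exact SL2CentralExtension.layer_f₀ hf₀ hl
  let π' : E ⧸ W →* SL(2, ZMod (p ^ (e - 1))) := QuotientGroup.lift W (r.comp π) hWker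
  have hπ' : ∀ x : E, π' (QuotientGroup.mk x) = r (π x) := fun x ↦ rfl
  have hsurj' : Function.Surjective π' := by
    intro y
    obtain ⟨Y, hY⟩ := SL2TopLayer.map_castHom_surjective (p ^ e) (pow_dvd_pow p (Nat.sub_le e 1)) y
    obtain ⟨x, hx⟩ := hsurj Y
    exact ⟨QuotientGroup.mk x, by rw [hπ', hx]; exact hY⟩
  -- kernel elements of π' come from W · ker π
  haveI : π.ker.Normal := inferInstance
  have hgenWK : e₀ ∈ W ⊔ π.ker ∧ h₁ ∈ W ⊔ π.ker ∧ f₀ ∈ W ⊔ π.ker := by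
    obtain ⟨meW, mhW, mfW⟩ := (gens_mem_closure : e' ∈ W ∧ h' ∈ W ∧ f' ∈ W)
    have hwK : w ∈ π.ker := hw1
    refine ⟨?_, ?_, ?_⟩
    · have : e₀ = e' * w⁻¹ := by rw [he', mul_inv_cancel_right]
      rw [this]; exact mul_mem (Subgroup.mem_sup_left meW) (Subgroup.mem_sup_right (inv_mem hwK))
    · have : h₁ = h' * w⁻¹ := by rw [hh', mul_inv_cancel_right]
      rw [this]; exact mul_mem (Subgroup.mem_sup_left mhW) (Subgroup.mem_sup_right (inv_mem hwK))
    · have : f₀ = f' * w := by rw [hf', inv_mul_cancel_right]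
      rw [this]; exact mul_mem (Subgroup.mem_sup_left mfW) (Subgroup.mem_sup_right hwK)
  have hker' : ∀ x : E, π' (QuotientGroup.mk x) = 1 → ∃ z : E, π z = 1 ∧ (QuotientGroup.mk x : E ⧸ W) =
      QuotientGroup.mk z := by
    intro x hx
    rw [hπ'] at hx
    obtain ⟨a, b', c, z, hz, hxz⟩ := SL2CentralExtension.exists_decomp he₀ hf₀ hh₁ ht hl he hx
    have hxWK : x ∈ W ⊔ π.ker := by
      rw [hxz]
      obtain ⟨m1, m2, m3⟩ := hgenWK
      exact mul_mem (mul_mem (mul_mem (pow_mem m1 _) (pow_mem m2 _)) (pow_mem m3 _))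
        (Subgroup.mem_sup_right hz)
    obtain ⟨w', hw', z', hz', hxe⟩ := Subgroup.mem_sup_of_normal_right.mp hxWK
    refine ⟨z', hz', ?_⟩
    rw [← hxe, QuotientGroup.mk_mul, (QuotientGroup.eq_one_iff _).mpr hw', one_mul]
  have hcen' : ∀ q : E ⧸ W, π' q = 1 → ∀ g : E ⧸ W, g * q = q * g := by
    intro q hq g
    induction q using QuotientGroup.induction_on with
    | H x =>
      induction g using QuotientGroup.induction_on with
      | H y =>
        obtain ⟨z, hz, hxz⟩ := hker' x hq
        rw [hxz, ← QuotientGroup.mk_mul, ← QuotientGroup.mk_mul, hcen z hz y]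
  have hexp' : ∀ q : E ⧸ W, π' q = 1 → q ^ p = 1 := by
    intro q hq
    induction q using QuotientGroup.induction_on with
    | H x =>
      obtain ⟨z, hz, hxz⟩ := hker' x hq
      rw [hxz, ← QuotientGroup.mk_pow, hexp z hz, QuotientGroup.mk_one]
  intro z hz hzc
  have h1 : π' (QuotientGroup.mk z) = 1 := by rw [hπ', hz, map_one]
  have h2 : (QuotientGroup.mk z : E ⧸ W) ∈ commutator (E ⧸ W) := by
    have := Subgroup.mem_map_of_mem (QuotientGroup.mk' W) hzc
    rw [commutator_def, Subgroup.map_commutator] at this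
    rw [commutator_def]
    exact Subgroup.commutator_mono le_top le_top this
  have h3 := IH (E ⧸ W) π' hsurj' hcen' hexp' _ h1 h2
  have h4 : z ∈ W := (QuotientGroup.eq_one_iff z).mp h3
  exact eq_one_of_mem_closure_of_map_eq_one he heh hef hfh pe ph pf hE hF hH h4 hz

/-- Induction on `e` (modulus form), odd `p`. [cite: Beyl1986, Theorem (M(SL(2,ℤ/m)) = 0 for 4 ∤ m), p-primary
part] -/
theorem ker_inf_commutator_eq_bot_odd_aux (p : ℕ) [Fact p.Prime] (hp2 : p ≠ 2) :
    ∀ (e n : ℕ), n = p ^ e → ∀ (E : Type u) [Group E] (π : E →* SL(2, ZMod n)), Function.Surjective π →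
      (∀ z : E, π z = 1 → ∀ g : E, g * z = z * g) → (∀ z : E, π z = 1 → z ^ p = 1) →
      ∀ z : E, π z = 1 → z ∈ commutator E → z = 1 := by
  intro e
  induction e with
  | zero =>
    intro n hn E _ π _ hcen _ z _ hzc
    subst hn
    haveI : Subsingleton (ZMod (p ^ 0)) := by rw [pow_zero]; infer_instance
    haveI : Subsingleton SL(2, ZMod (p ^ 0)) :=
      ⟨fun a b ↦ Subtype.ext (Subsingleton.elim _ _)⟩
    have hall : ∀ x : E, π x = 1 := fun x ↦ Subsingleton.elim _ _
    have hbot : commutator E = ⊥ := by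
      rw [commutator_def, Subgroup.commutator_eq_bot_iff_le_centralizer]
      intro g _
      rw [Subgroup.mem_centralizer_iff]
      intro h _
      exact hcen g (hall g) h
    rw [hbot, Subgroup.mem_bot] at hzc
    exact hzc
  | succ k ih =>
    intro n hn E _ π hsurj hcen hexp
    rcases k with _ | k
    · rw [zero_add, pow_one] at hn
      subst hn
      exact base _ π hsurj hcen hexp
    · subst hn
      exact step_odd _ hp2 (k + 1 + 1) (by omega) π hsurj hcen hexp
        (fun E' _ π' hs hc he ↦ ih _ rfl E' π' hs hc he)

/-- **Theorem (the `p`-primary part of the Schur multiplier of `SL₂(ℤ/p^e)` vanishes for every ODD prime `p`).**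
For an odd prime `p`, every `e ≥ 0` and every surjection `π : E → SL₂(ℤ/p^e)` whose kernel is central of
exponent `p`: `ker π ∩ [E, E] = 1`.  This extends `SL2SchurMultiplier.eq_one_of_mem_ker_of_mem_commutator` (`p ≥
5`) to `p = 3`; it is the `p`-part of [Beyl1986]'s `M(SL₂(ℤ/m)) = 0` for `4 ∤ m`, i.e. the input at `ℓ = p` odd,
`p² ∣ N`, of the invariant form of [CalegariDimitrovTang2025, Cor. 4.5.3].  (`p = 2` is genuinely different:
`M(SL₂(ℤ/2^e)) = ℤ/2` for `e ≥ 2`.) [cite: Beyl1986, Theorem (M(SL(2,ℤ/m)) = 0 for 4 ∤ m), p-primary part] -/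
theorem eq_one_of_mem_ker_of_mem_commutator_odd (p : ℕ) [Fact p.Prime] (hp2 : p ≠ 2) (e : ℕ) {E : Type u}
    [Group E] (π : E →* SL(2, ZMod (p ^ e))) (hsurj : Function.Surjective π)
    (hcen : ∀ z : E, π z = 1 → ∀ g : E, g * z = z * g) (hexp : ∀ z : E, π z = 1 → z ^ p = 1)
    {z : E} (hz : π z = 1) (hzc : z ∈ commutator E) : z = 1 :=
  ker_inf_commutator_eq_bot_odd_aux p hp2 e (p ^ e) rfl E π hsurj hcen hexp z hz hzc

end induction

end SL2SchurMultiplierOdd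

end Literature.GroupTheory.ArithmeticGroups
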